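import Literature.MathematicalPhysics.QuantumFieldTheory.Balaban1983to89.B8Ineq130Rec
import Literature.MathematicalPhysics.QuantumFieldTheory.Balaban1983to89.BlockAveragingZdCovariance
import Literature.MathematicalPhysics.QuantumFieldTheory.Balaban1983to89.B8Eq115GaugeFixing

/-!
# `Balaban1983to89.B8Eq115GaugeFixingRec` — [Balaban1985RegularSpaces] (1.15)∕(1.14): EXISTENCE AND UNIQUENESS of the block axial gauge with the global
# axial gauge of `Ūᵏ` on top, on the `ℤᵈ` tower of the RECORD's symmetric block averages [Balaban1987RG1] (0.4) (`BlockAveragingZd.avgIterZ`, CENTRED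
# blocks, contours from the block centres); (1.130) for every orbit FROM (1.128) displayed

statement-level skeleton of published theorems with citation tags; proofs where landed; nothing here is a claim about the Yang–Mills mass gap

CITATION HEADER.  [6] = T. Bałaban, *Spaces of regular gauge field configurations on a lattice and gauge fixing conditions*, Commun. Math. Phys. **99**
(1985) 75–102 [Balaban1985RegularSpaces], p. 78: *«An axial gauge is defined by the equations: for x_j ∈ Λ_j, j = 1, …, k, we put Ū^{j−1}(Γ_{x_j,x_{j−1}}) = 1 for
x_{j−1} ∈ B(x_j), …, U(Γ_{x₁,x}) = 1 for x ∈ B(x₁). (1.15)  It is easy to see that these equations together with (1.14) for gauge transformations determine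
uniquely an element in each orbit.»*; p. 98: *«We apply a gauge transformation to U₀, such that the gauge transformed configuration U₀′ satisfies the axial gauge
conditions (1.15), and Ū₀′ᵏ satisfies the global axial gauge conditions on □̃^{(k)} … Ū₀′ᵏ(Γ_{y,x}) = 1 for x ∈ □̃^{(k)}, where y is a center of □̃^{(k)}.»*
[I] = [Balaban1987RG1] (0.3)–(0.4) pp. 252–253 («a block … with a center at y»; the averaging of record), (0.6) p. 253 (its gauge covariance); [3] =
[Balaban1985Averaging] (8) p. 18, (11) p. 19, (45) p. 24, p. 24 («V₀ = V^{v₀} satisfies the conditions V₀(Γ_{y,x}) = 1»).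
Cell `pub-ymgap`, seat `pub-ymgap-dag-n05-d` g23 — «N05-REC» road, item R2 (director-ym №254∕№255; LEAD PEN dag-n05-e; TOKEN RULE `N05-REC-LEAD.md` §2:
(T1) `avgIter ↦ avgIterZ`; (T2) CENTRED blocks, block map `B8Ineq130Rec.fl` (`⌊(x + s𝟙)∕L⌋`), block points `L•z + offZ L r`; (T3) the contours ARE the
engine's `axialFn ∕ treeWord` from the block centre (= the record's `radialContourData`, `NrmOfRecordWide`); (T5) engine names, definitions `+Z`).
Twin of `B8Eq115GaugeFixing` §2–§5; structure-free parts REUSED by name (`gaugeAct_mul`, `gaugeAct_mem_of`, `axialFn_self`, `axialFn_gaugeAct`,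
`hol_treeWord_gaugeAct`, `pdevOn_gaugeAct`, …).  `--kind definition --supports stmt-QuantumFields-20541` (K0⁷; count-neutral).

WHAT IS PROVED (kernel, sorry-free).
* §1 the centred block map: `fl_smul` (`fl L (L•z) = z`), `fl_block` (`fl L (L•z + offZ L r) = z`), `exists_block` (every `x` is `L•fl L x + offZ L r`) — odd `L`.
* §2 **`tgZ`** ∕ **`towerGaugeZ`** — THE EXPLICIT GAUGE TRANSFORMATION of p. 78 ∕ p. 98 for the record tower: top `u_k = Ūᵏ(Γ_{y,·})`, downwards `u_j(x) =
  u_{j+1}(z)·Ūʲ(Γ_{L•z,x})` for `x ∈ B(L•z)` CENTRED (`z = fl L x`); `tgZ_succ_smul`, `tgZ_succ_block`, `tgZ_add_pow_smul`, `tgZ_top` ((1.14) at the top centre),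
  `tgZ_mem`, `tgZ_one`; and the algebra «(1.15) + top axial gauge FROM THE COVARIANCE»: `h15_of_cov`, `top_of_cov`, `const_of_cov` (the engine's §2 with `fl ↦`
  centred `fl`, `boxVec ↦ offZ`).
* §3 ★★ `gaugeFix_global_of_mem` — EXISTENCE: for `U` with values in `G ≤ U1 𝔸` whose record averages `avgIterZ L U j`, `j ≤ k`, are `G`-valued (in the engine
  this follows from `AvgClosed` + (1.7) by [3] Prop. 2 — the record's Prop. 2 is the road's R1, so the membership is DISPLAYED), `u := towerGaugeZ L U k y` and
  `U′ := U^{u}` are `G`-valued, `sup_p|U′(∂p) − 1| = sup_p|U(∂p) − 1|`, `Ū′ʲ = (Ūʲ)^{u∘(Lʲ·)}` for EVERY `j` (the record's covariance (0.6)∕(11) is UNCONDITIONAL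
  on the unguarded edition: `BlockAveragingZdCovariance.avgIterZ_gaugeAct_units`), (1.15) between ALL consecutive levels at every centred block, and the global
  axial gauge of the top level at `y`; ★★ `gaugeFix_unique` ∕ `gaugeFix_const_mul` ∕ ★ `gaugeFix_unique_normalised` — UNIQUENESS up to ∕ with the constant,
  needing NO smallness at all for the record (covariance unconditional).
* §4 **`localGaugeZ`** (the tower gauge of the clamped extension of `U₀|□̃`, centred cube tower) and ★ `ineq130_global_fixed_of128` — (1.130) FOR EVERY ORBIT on the
  global carrier from (1.128) displayed for `U`'s averages (gauge-invariant, transferred to `U′`), via `B8Ineq130Rec.ineq130_of128`.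

HONEST SCOPE.  (i) As the engine's (i)–(v) (ℤᵈ towers, (1.14) represented by `u(Lᵏy) = 1`, `≤`∕`<`); odd `L`.  (ii) The `G`-membership of the record averages and
(1.128) are DISPLAYED (R1's Prop. 2 for the record discharges both; the engine-signature corollaries `gaugeFix_global ∕ ineq130_fixed` ((1.7) + `AvgClosed` in)
are then ONE `obtain` away — TODO(R1), on the cell bus).  (iii) Nothing of [3]∕[6]∕[I] beyond this bookkeeping is asserted; `HThm4Rec` UNDISCHARGED; N05 ∕ N07
NOT discharged; counts unmoved; one finite 𝕋⁴ programme at fixed ε — nothing continuum ∕ ℝ⁴ ∕ OS ∕ mass gap ∕ Clay.  No `instance`, no `notation`, no `sorry`.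
-/

noncomputable section

open scoped BigOperators
open NormedSpace Finset

namespace Literature.MathematicalPhysics.QuantumFieldTheory.Balaban1983to89.B8Eq115GaugeFixingRec

open B7Prop1Explicit MatrixLog BlockAveragingZd BlockAveragingZdCovariance B8Lemma1NonAbelianRecLoops B8Lemma1NonAbelianRec
  B8Ineq130Rec
open B7Prop2Explicit (rescale rescale_apply pdev C0 hol_mem_of)
open B7Prop1Local (InBox AgreeOn clampCfg clampCfg_agree clampCfg_mem pdev_clampCfg_le pdevOn)
open B8Lemma1NonAbelian (lowPart zsmul_e_apply zsmul_e_apply_self e_apply_self e_apply_of_ne e_nonneg)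
open B8Ineq129 (le_of_add_e_le plaqSmall_of_pdev)
open B8Ineq130 (hol_one axialFn_one gaugeAct_one aLev bound130 inBox_of_le axialFn_congr)
open B7AvgGaugeCovariance (uLev uLev_apply pdev_gaugeAct norm_hol_gaugeAct_plaqWord)
open B8Eq115GaugeFixing (gaugeAct_mul gaugeAct_mem_of gaugeAct_agree axialFn_self axialFn_gaugeAct hol_treeWord_gaugeAct pdevOn_gaugeAct)

-- `Site` alone would resolve to the torus sites of `Setup.lean`; re-export the `ℤᵈ` sites of `B7Prop1Explicit`.
export B7Prop1Explicit (Site)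

variable {d : ℕ}

/-! ## §1 The centred block map `fl L x = ⌊(x + s𝟙)∕L⌋` (odd `L = 2s+1`) -/

/-- `fl L (L•z) = z` (the centre of the block maps to its coarse site). [cite: Balaban1987RG1, (0.3) p.252 (bookkeeping)] -/
theorem fl_smul {L s : ℕ} (hL : L = 2 * s + 1) (z : Site d) : fl L ((L : ℤ) • z) = z := by
  funext i
  have hs : (L - 1) / 2 = s := by omega
  have hLpos : (0 : ℤ) < L := by exact_mod_cast (show 0 < L by omega)
  simp only [fl, B8Ineq130.fl, Pi.add_apply, Pi.smul_apply, smul_eq_mul, halfVec, hs]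
  rw [show (L : ℤ) * z i + (s : ℤ) = (s : ℤ) + (L : ℤ) * z i by ring, Int.add_mul_ediv_left _ _ hLpos.ne',
    Int.ediv_eq_zero_of_lt (by positivity) (by omega), zero_add]

/-- `fl L (L•z + n) = z` for a centred offset `n = offZ L r`. [cite: Balaban1987RG1, (0.3) p.252 (bookkeeping)] -/
theorem fl_block {L s : ℕ} (hL : L = 2 * s + 1) (z : Site d) (r : Fin d → Fin L) : fl L ((L : ℤ) • z + offZ L r) = z := by
  funext i
  have hs : (L - 1) / 2 = s := by omega
  have hLpos : (0 : ℤ) < L := by exact_mod_cast (show 0 < L by omega)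
  have hr := (r i).isLt
  simp only [fl, B8Ineq130.fl, Pi.add_apply, Pi.smul_apply, smul_eq_mul, halfVec, hs, offZ_apply]
  rw [show (L : ℤ) * z i + (((r i : ℕ) : ℤ) - (s : ℤ)) + (s : ℤ) = ((r i : ℕ) : ℤ) + (L : ℤ) * z i by ring,
    Int.add_mul_ediv_left _ _ hLpos.ne', Int.ediv_eq_zero_of_lt (by positivity) (by omega), zero_add]

/-- Every site is `L•z + offZ L r` with `z = fl L x` (the centred block decomposition of `ℤᵈ`). [cite: Balaban1987RG1, (0.3) p.252 (bookkeeping)] -/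
theorem exists_block {L s : ℕ} (hL : L = 2 * s + 1) (x : Site d) : ∃ r : Fin d → Fin L, x = (L : ℤ) • fl L x + offZ L r :=
  inBlock_fl hL x

/-! ## §2 The tower gauge transformation for the record tower and the algebra of (1.15) -/

section Algebra

variable {G : Type*} [Group G]

/-- **THE TOWER GAUGE TRANSFORMATION (record, CENTRED blocks)** solving (1.15) with the global axial gauge of the top level at `y`: depth `0` (level `k`):
`u_k(x) = W_k(Γ_{y,x})`; depth `n + 1` (level `j = k − n − 1`): `u_j(x) = u_{j+1}(z)·W_j(Γ_{L•z,x})` for `x ∈ B(L•z) = L•z + [−s,s]ᵈ`, `z = fl L x` — the engine's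
`tg` with the centred block map. [cite: Balaban1985RegularSpaces, (1.15) p.78; p.98; Balaban1987RG1, (0.3) p.252] -/
def tgZ (L : ℕ) (W : ℕ → Site d → Fin d → G) (k : ℕ) (y : Site d) : ℕ → Site d → G
  | 0 => axialFn (W k) y
  | n + 1 => fun x => tgZ L W k y n (fl L x) * axialFn (W (k - (n + 1))) ((L : ℤ) • fl L x) x

/-- `tgZ_zero` — the top level is the axial gauge at `y`. [cite: Balaban1985RegularSpaces, p.98] -/
@[simp] theorem tgZ_zero (L : ℕ) (W : ℕ → Site d → Fin d → G) (k : ℕ) (y : Site d) : tgZ L W k y 0 = axialFn (W k) y := rfl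

/-- `tgZ_succ` — the recursion `u_j(x) = u_{j+1}(z)·W_j(Γ_{L•z,x})`. [cite: Balaban1985RegularSpaces, (1.15) p.78] -/
theorem tgZ_succ (L : ℕ) (W : ℕ → Site d → Fin d → G) (k : ℕ) (y : Site d) (n : ℕ) (x : Site d) :
    tgZ L W k y (n + 1) x = tgZ L W k y n (fl L x) * axialFn (W (k - (n + 1))) ((L : ℤ) • fl L x) x := rfl

/-- CONSISTENCY ACROSS LEVELS: `u_j(L•z) = u_{j+1}(z)` (the block CENTRE carries the coarse value). [cite: Balaban1985RegularSpaces, (1.15) p.78 (bookkeeping)] -/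
theorem tgZ_succ_smul {L s : ℕ} (hL : L = 2 * s + 1) (W : ℕ → Site d → Fin d → G) (k : ℕ) (y : Site d) (n : ℕ) (z : Site d) :
    tgZ L W k y (n + 1) ((L : ℤ) • z) = tgZ L W k y n z := by
  rw [tgZ_succ, fl_smul hL, axialFn_self, mul_one]

/-- The recursion at a block point `x = L•z + offZ L r`. [cite: Balaban1985RegularSpaces, (1.15) p.78 (bookkeeping)] -/
theorem tgZ_succ_block {L s : ℕ} (hL : L = 2 * s + 1) (W : ℕ → Site d → Fin d → G) (k : ℕ) (y : Site d) (n : ℕ) (z : Site d)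
    (r : Fin d → Fin L) :
    tgZ L W k y (n + 1) ((L : ℤ) • z + offZ L r) = tgZ L W k y n z * axialFn (W (k - (n + 1))) ((L : ℤ) • z) ((L : ℤ) • z + offZ L r) := by
  rw [tgZ_succ, fl_block hL]

/-- CONSISTENCY, iterated: `u_{m}`-values are the `u_{m+j}`-values at `Lʲ`-multiples. [cite: Balaban1985RegularSpaces, (1.15) p.78 (bookkeeping)] -/
theorem tgZ_add_pow_smul {L s : ℕ} (hL : L = 2 * s + 1) (W : ℕ → Site d → Fin d → G) (k : ℕ) (y : Site d) (m : ℕ) :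
    ∀ (j : ℕ) (x : Site d), tgZ L W k y (m + j) (((L : ℤ) ^ j) • x) = tgZ L W k y m x
  | 0, x => by simp
  | j + 1, x => by
    rw [pow_succ', mul_smul, ← add_assoc, tgZ_succ_smul hL, tgZ_add_pow_smul hL W k y m j x]

/-- NORMALISATION: `u(Lᵏy) = 1` — the tower gauge transformation is `1` at the fine site under the top centre (print's (1.14) `u(y) = 1`).
[cite: Balaban1985RegularSpaces, (1.14) p.78] -/
theorem tgZ_top {L s : ℕ} (hL : L = 2 * s + 1) (W : ℕ → Site d → Fin d → G) (k : ℕ) (y : Site d) :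
    tgZ L W k y k (((L : ℤ) ^ k) • y) = 1 := by
  have h := tgZ_add_pow_smul hL W k y 0 k y
  rw [zero_add] at h
  rw [h, tgZ_zero, axialFn_self]

/-- The tower gauge transformation of an `S`-valued tower is `S`-valued. [cite: Balaban1985RegularSpaces, (1.15) p.78 (bookkeeping)] -/
theorem tgZ_mem {S : Subgroup G} {L : ℕ} {W : ℕ → Site d → Fin d → G} {k : ℕ}
    (hW : ∀ j ≤ k, ∀ x κ, W j x κ ∈ S) (y : Site d) : ∀ (n : ℕ) (x : Site d), tgZ L W k y n x ∈ S
  | 0, x => hol_mem_of (hW k le_rfl) _ _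
  | n + 1, x => S.mul_mem (tgZ_mem hW y n _) (hol_mem_of (hW (k - (n + 1)) (by omega)) _ _)

/-- The tower gauge transformation of the trivial tower is trivial. [cite: Balaban1985RegularSpaces, (1.15) p.78 (bookkeeping)] -/
theorem tgZ_one (L k : ℕ) (y : Site d) : ∀ n, tgZ L (fun _ => (1 : Site d → Fin d → G)) k y n = 1
  | 0 => by funext x; simp [axialFn_one]
  | n + 1 => by funext x; rw [tgZ_succ, tgZ_one L k y n, axialFn_one]; simp

/-- **(1.15) FROM THE COVARIANCE** (record tower, centred blocks): if `W′_j = (W_j)^{u∘(Lʲ·)}` for `u = tgZ … k`, then `W′_j(Γ_{L•z,x}) = 1` for every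
`x = L•z + offZ L r ∈ B(L•z)`, `j < k`. [cite: Balaban1985RegularSpaces, (1.15) p.78] -/
theorem h15_of_cov {L s : ℕ} (hL : L = 2 * s + 1) (W W' : ℕ → Site d → Fin d → G) (k : ℕ) (y : Site d)
    (hcov : ∀ j ≤ k, W' j = gaugeAct (uLev L (tgZ L W k y k) j) (W j))
    (n : ℕ) (hn : n < k) (z : Site d) (r : Fin d → Fin L) :
    axialFn (W' (k - (n + 1))) ((L : ℤ) • z) ((L : ℤ) • z + offZ L r) = 1 := by
  have hu : ∀ x, tgZ L W k y k (((L : ℤ) ^ (k - (n + 1))) • x) = tgZ L W k y (n + 1) x := fun x => by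
    have h := tgZ_add_pow_smul hL W k y (n + 1) (k - (n + 1)) x
    have hkj : n + 1 + (k - (n + 1)) = k := by omega
    rwa [hkj] at h
  rw [hcov (k - (n + 1)) (by omega)]
  simp only [axialFn_gaugeAct, uLev_apply, hu]
  rw [tgZ_succ_smul hL, tgZ_succ_block hL]
  exact mul_inv_cancel _

/-- **THE GLOBAL AXIAL GAUGE OF THE TOP LEVEL FROM THE COVARIANCE**: `W′_k(Γ_{y,z}) = 1` since `u_k = W_k(Γ_{y,·})`.
[cite: Balaban1985RegularSpaces, p.98; Balaban1985Averaging, p.24] -/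
theorem top_of_cov {L s : ℕ} (hL : L = 2 * s + 1) (W W' : ℕ → Site d → Fin d → G) (k : ℕ) (y : Site d)
    (hcov : W' k = gaugeAct (uLev L (tgZ L W k y k) k) (W k)) (z : Site d) :
    hol (W' k) y (treeWord (z - y)) = 1 := by
  have hu : ∀ x, tgZ L W k y k (((L : ℤ) ^ k) • x) = axialFn (W k) y x := fun x => by
    have h := tgZ_add_pow_smul hL W k y 0 k x
    rw [zero_add] at h
    exact h
  rw [hcov, hol_treeWord_gaugeAct]
  simp only [uLev_apply, hu, axialFn_self, one_mul]
  exact mul_inv_cancel _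

/-- **UNIQUENESS UP TO A CONSTANT (algebraic core)** for the record tower: as the engine's `const_of_cov` with centred blocks.
[cite: Balaban1985RegularSpaces, p.78 («determine uniquely an element in each orbit»)] -/
theorem const_of_cov {L s : ℕ} (hL : L = 2 * s + 1) (W₁ W₂ : ℕ → Site d → Fin d → G) (k : ℕ) (y : Site d)
    (w : Site d → G) (hcov : ∀ j ≤ k, W₂ j = gaugeAct (uLev L w j) (W₁ j))
    (h15₁ : ∀ n, n < k → ∀ (z : Site d) (r : Fin d → Fin L),
      axialFn (W₁ (k - (n + 1))) ((L : ℤ) • z) ((L : ℤ) • z + offZ L r) = 1)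
    (h15₂ : ∀ n, n < k → ∀ (z : Site d) (r : Fin d → Fin L),
      axialFn (W₂ (k - (n + 1))) ((L : ℤ) • z) ((L : ℤ) • z + offZ L r) = 1)
    (htop₁ : ∀ z, hol (W₁ k) y (treeWord (z - y)) = 1)
    (htop₂ : ∀ z, hol (W₂ k) y (treeWord (z - y)) = 1) :
    ∀ x, w x = w (((L : ℤ) ^ k) • y) := by
  suffices H : ∀ n ≤ k, ∀ x, w (((L : ℤ) ^ (k - n)) • x) = w (((L : ℤ) ^ k) • y) by
    intro x
    simpa using H k le_rfl x
  intro n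
  induction n with
  | zero =>
    intro _ x
    have h := htop₂ x
    rw [hcov k le_rfl, hol_treeWord_gaugeAct, uLev_apply, uLev_apply, htop₁ x, mul_one, mul_inv_eq_one] at h
    rw [Nat.sub_zero]
    exact h.symm
  | succ n ih =>
    intro hn x
    obtain ⟨r, hx⟩ := exists_block hL x
    have h := h15₂ n (by omega) (fl L x) r
    rw [hcov (k - (n + 1)) (by omega)] at h
    simp only [axialFn_gaugeAct, uLev_apply, h15₁ n (by omega) (fl L x) r, mul_one, mul_inv_eq_one] at h
    rw [← hx] at h
    rw [← h, smul_smul, ← pow_succ, show k - (n + 1) + 1 = k - n by omega]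
    exact ih (by omega) (fl L x)

end Algebra

/-! ## §3 Existence and uniqueness of the gauge for the record tower (p. 78, p. 98) -/

section Analytic

variable {𝔸 : Type*} [NormedRing 𝔸] [NormOneClass 𝔸] [NormedAlgebra ℂ 𝔸] [CompleteSpace 𝔸]

/-- The gauge transformation of p. 98 on the fine lattice for the RECORD tower `Ūʲ = avgIterZ L U j`, `j ≤ k`, with top centre `y`.
[cite: Balaban1985RegularSpaces, p.98, (1.15) p.78; Balaban1987RG1, (0.4) p.253] -/
abbrev towerGaugeZ (L : ℕ) (U : Site d → Fin d → 𝔸ˣ) (k : ℕ) (y : Site d) : Site d → 𝔸ˣ :=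
  tgZ L (avgIterZ L U) k y k

omit [NormOneClass 𝔸] in
/-- NORMALISATION (print's (1.14) at the top centre): `u(Lᵏy) = 1` for `u = towerGaugeZ L U k y`. [cite: Balaban1985RegularSpaces, (1.14) p.78] -/
theorem towerGaugeZ_top {L s : ℕ} (hL : L = 2 * s + 1) (U : Site d → Fin d → 𝔸ˣ) (k : ℕ) (y : Site d) :
    towerGaugeZ L U k y (((L : ℤ) ^ k) • y) = 1 :=
  tgZ_top hL (avgIterZ L U) k y

/-- **EXISTENCE OF THE GAUGE (p. 78 (1.15) + p. 98), RECORD TOWER, GLOBAL CARRIER, from the `G`-membership of the averages.**  Let `G ≤ U1 𝔸`, `U`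
`G`-valued, and suppose every record average `avgIterZ L U j`, `j ≤ k`, is `G`-valued (engine: from `AvgClosed` + (1.7) by [3] Prop. 2; here DISPLAYED).
Then for `u := towerGaugeZ L U k y` and `U′ := U^{u}`: `u`, `U′` are `G`-valued; `sup_p |U′(∂p) − 1| = sup_p |U(∂p) − 1|`; `Ū′ʲ = (Ūʲ)^{u∘(Lʲ·)}` for EVERY `j`
(the record's covariance is unconditional); (1.15) holds for `U′` between all consecutive levels at every CENTRED block; and the top level is in the global
axial gauge at `y`. [cite: Balaban1985RegularSpaces, (1.15) p.78, p.98; Balaban1987RG1, (0.6) p.253] -/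
theorem gaugeFix_global_of_mem {L s : ℕ} (hL : L = 2 * s + 1) {G : Subgroup 𝔸ˣ} (hG1 : G ≤ U1 𝔸) (k : ℕ)
    (U : Site d → Fin d → 𝔸ˣ) (hU : ∀ x κ, U x κ ∈ G) (hmemG : ∀ j ≤ k, ∀ x μ, avgIterZ L U j x μ ∈ G) (y : Site d) :
    (∀ x, towerGaugeZ L U k y x ∈ G) ∧
    (∀ x κ, gaugeAct (towerGaugeZ L U k y) U x κ ∈ G) ∧
    pdev (gaugeAct (towerGaugeZ L U k y) U) = pdev U ∧
    (∀ j, avgIterZ L (gaugeAct (towerGaugeZ L U k y) U) j =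
      gaugeAct (uLev L (towerGaugeZ L U k y) j) (avgIterZ L U j)) ∧
    (∀ n, n < k → ∀ (z : Site d) (r : Fin d → Fin L),
      axialFn (avgIterZ L (gaugeAct (towerGaugeZ L U k y) U) (k - (n + 1))) ((L : ℤ) • z)
        ((L : ℤ) • z + offZ L r) = 1) ∧
    (∀ z, hol (avgIterZ L (gaugeAct (towerGaugeZ L U k y) U) k) y (treeWord (z - y)) = 1) := by
  have huG : ∀ x, towerGaugeZ L U k y x ∈ G := fun x => tgZ_mem hmemG y k x
  have huU : ∀ x, towerGaugeZ L U k y x ∈ U1 𝔸 := fun x => hG1 (huG x)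
  have hcov : ∀ j, avgIterZ L (gaugeAct (towerGaugeZ L U k y) U) j =
      gaugeAct (uLev L (towerGaugeZ L U k y) j) (avgIterZ L U j) := avgIterZ_gaugeAct_units L (towerGaugeZ L U k y) U
  exact ⟨huG, fun x κ => gaugeAct_mem_of hU huG x κ, pdev_gaugeAct huU U, hcov,
    fun n hn z r => h15_of_cov hL (avgIterZ L U) (avgIterZ L (gaugeAct (towerGaugeZ L U k y) U)) k y (fun j _ => hcov j) n hn z r,
    fun z => top_of_cov hL (avgIterZ L U) (avgIterZ L (gaugeAct (towerGaugeZ L U k y) U)) k y (hcov k) z⟩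

omit [NormOneClass 𝔸] in
/-- **UNIQUENESS OF THE GAUGE UP TO A CONSTANT (p. 78), RECORD TOWER — NO SMALLNESS NEEDED**: if two gauge transformations `u₁`, `u₂` both bring `U` to a
configuration satisfying (1.15) (centred blocks) between all consecutive levels and the global axial gauge of the top level at `y`, then
`u₂(x) = u₂(Lᵏy)u₁(Lᵏy)⁻¹·u₁(x)` for all `x` (the record's covariance `\overline{(U^u)}^{\,j} = (Ūʲ)^{u_j}` holds for EVERY invertible `u`).
[cite: Balaban1985RegularSpaces, p.78; Balaban1987RG1, (0.6) p.253] -/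
theorem gaugeFix_unique {L s : ℕ} (hL : L = 2 * s + 1) (k : ℕ) (U : Site d → Fin d → 𝔸ˣ) (y : Site d) (u₁ u₂ : Site d → 𝔸ˣ)
    (h15₁ : ∀ n, n < k → ∀ (z : Site d) (r : Fin d → Fin L),
      axialFn (avgIterZ L (gaugeAct u₁ U) (k - (n + 1))) ((L : ℤ) • z) ((L : ℤ) • z + offZ L r) = 1)
    (h15₂ : ∀ n, n < k → ∀ (z : Site d) (r : Fin d → Fin L),
      axialFn (avgIterZ L (gaugeAct u₂ U) (k - (n + 1))) ((L : ℤ) • z) ((L : ℤ) • z + offZ L r) = 1)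
    (htop₁ : ∀ z, hol (avgIterZ L (gaugeAct u₁ U) k) y (treeWord (z - y)) = 1)
    (htop₂ : ∀ z, hol (avgIterZ L (gaugeAct u₂ U) k) y (treeWord (z - y)) = 1) :
    ∀ x, u₂ x = u₂ (((L : ℤ) ^ k) • y) * (u₁ (((L : ℤ) ^ k) • y))⁻¹ * u₁ x := by
  set w : Site d → 𝔸ˣ := fun x => u₂ x * (u₁ x)⁻¹ with hw
  have hmul : gaugeAct u₂ U = gaugeAct w (gaugeAct u₁ U) := by
    rw [← gaugeAct_mul]
    congr 1
    funext x
    simp [hw]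
  have hcov : ∀ j ≤ k, avgIterZ L (gaugeAct u₂ U) j = gaugeAct (uLev L w j) (avgIterZ L (gaugeAct u₁ U) j) := fun j _ => by
    rw [hmul]
    exact avgIterZ_gaugeAct_units L w (gaugeAct u₁ U) j
  intro x
  have hc := const_of_cov hL (avgIterZ L (gaugeAct u₁ U)) (avgIterZ L (gaugeAct u₂ U)) k y w hcov h15₁ h15₂ htop₁ htop₂ x
  simp only [hw] at hc
  calc u₂ x = u₂ x * (u₁ x)⁻¹ * u₁ x := by rw [inv_mul_cancel_right]
    _ = u₂ (((L : ℤ) ^ k) • y) * (u₁ (((L : ℤ) ^ k) • y))⁻¹ * u₁ x := by rw [hc]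

omit [NormOneClass 𝔸] in
/-- **CONSTANTS ACT** (the converse of `gaugeFix_unique`), record tower: if `u` brings `U` to (1.15) + the top axial gauge at `y`, so does `c·u` for every
constant unit `c`. [cite: Balaban1985RegularSpaces, p.78; Balaban1987RG1, (0.6) p.253] -/
theorem gaugeFix_const_mul {L s : ℕ} (hL : L = 2 * s + 1) (k : ℕ) (U : Site d → Fin d → 𝔸ˣ) (y : Site d) (u : Site d → 𝔸ˣ) (c : 𝔸ˣ)
    (h15 : ∀ n, n < k → ∀ (z : Site d) (r : Fin d → Fin L),
      axialFn (avgIterZ L (gaugeAct u U) (k - (n + 1))) ((L : ℤ) • z) ((L : ℤ) • z + offZ L r) = 1)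
    (htop : ∀ z, hol (avgIterZ L (gaugeAct u U) k) y (treeWord (z - y)) = 1) :
    (∀ n, n < k → ∀ (z : Site d) (r : Fin d → Fin L),
      axialFn (avgIterZ L (gaugeAct (fun x => c * u x) U) (k - (n + 1))) ((L : ℤ) • z)
        ((L : ℤ) • z + offZ L r) = 1) ∧
    (∀ z, hol (avgIterZ L (gaugeAct (fun x => c * u x) U) k) y (treeWord (z - y)) = 1) := by
  have hs := hL
  have hmul : gaugeAct (fun x => c * u x) U = gaugeAct (fun _ => c) (gaugeAct u U) := by
    rw [← gaugeAct_mul]; rfl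
  have hcov : ∀ j, avgIterZ L (gaugeAct (fun x => c * u x) U) j =
      gaugeAct (uLev L (fun _ => c) j) (avgIterZ L (gaugeAct u U) j) := fun j => by
    rw [hmul]
    exact avgIterZ_gaugeAct_units L (fun _ => c) (gaugeAct u U) j
  refine ⟨fun n hn z r => ?_, fun z => ?_⟩
  · rw [hcov]
    simp only [axialFn_gaugeAct, uLev_apply, h15 n hn z r, mul_one, mul_inv_cancel]
  · rw [hcov k]
    simp only [hol_treeWord_gaugeAct, uLev_apply, htop z, mul_one, mul_inv_cancel]

omit [NormOneClass 𝔸] in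
/-- **EXACT UNIQUENESS UNDER THE NORMALISATION `u(Lᵏy) = 1`**, record tower: a gauge transformation `u` with `u(Lᵏy) = 1` bringing `U` to (1.15) between all
consecutive levels and to the global axial gauge of the top level at `y` IS `towerGaugeZ L U k y` (print's (1.15) «together with (1.14) … determine uniquely an
element in each orbit»; no smallness needed for the record). [cite: Balaban1985RegularSpaces, (1.14)–(1.15) p.78; Balaban1987RG1, (0.6) p.253] -/
theorem gaugeFix_unique_normalised {L s : ℕ} (hL : L = 2 * s + 1) (k : ℕ) (U : Site d → Fin d → 𝔸ˣ) (y : Site d) (u : Site d → 𝔸ˣ)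
    (hnorm : u (((L : ℤ) ^ k) • y) = 1)
    (h15 : ∀ n, n < k → ∀ (z : Site d) (r : Fin d → Fin L),
      axialFn (avgIterZ L (gaugeAct u U) (k - (n + 1))) ((L : ℤ) • z) ((L : ℤ) • z + offZ L r) = 1)
    (htop : ∀ z, hol (avgIterZ L (gaugeAct u U) k) y (treeWord (z - y)) = 1) :
    u = towerGaugeZ L U k y := by
  have hcov : ∀ j, avgIterZ L (gaugeAct (towerGaugeZ L U k y) U) j =
      gaugeAct (uLev L (towerGaugeZ L U k y) j) (avgIterZ L U j) := avgIterZ_gaugeAct_units L (towerGaugeZ L U k y) U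
  have h15₁ := fun n hn z r =>
    h15_of_cov hL (avgIterZ L U) (avgIterZ L (gaugeAct (towerGaugeZ L U k y) U)) k y (fun j _ => hcov j) n hn z r
  have htop₁ := fun z => top_of_cov hL (avgIterZ L U) (avgIterZ L (gaugeAct (towerGaugeZ L U k y) U)) k y (hcov k) z
  funext x
  have h := gaugeFix_unique hL k U y (towerGaugeZ L U k y) u h15₁ h15 htop₁ htop x
  rw [hnorm, towerGaugeZ_top hL, inv_one, one_mul, one_mul] at h
  exact h

/-! ## §4 The local carrier and (1.130) for every orbit from (1.128) displayed -/

/-- The gauge transformation for the LOCAL carrier, record tower: the tower gauge of the clamped extension (`B7Prop1Local.clampCfg`) of `U₀|□̃`,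
`□̃ = [tlo k, thi k]` the CENTRED finest cube (`B8Ineq130Rec.tlo∕thi`). [cite: Balaban1985RegularSpaces, p.98; Balaban1987RG1, (0.3) p.252] -/
abbrev localGaugeZ (L : ℕ) (lo hi : Site d) (U : Site d → Fin d → 𝔸ˣ) (k : ℕ) (y : Site d) : Site d → 𝔸ˣ :=
  towerGaugeZ L (clampCfg (tlo L lo k) (thi L hi k) U) k y

omit [NormedAlgebra ℂ 𝔸] [CompleteSpace 𝔸] in
/-- Plaquette bounds in boxes are gauge invariant (transfer of the displayed (1.128) from `Ūʲ` to `Ū′ʲ = (Ūʲ)^{u_j}`, `u_j` `U1`-valued).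
[cite: Balaban1985Averaging, (45) p.24 (bookkeeping)] -/
theorem plaqSmall_gaugeAct {u : Site d → 𝔸ˣ} (hu : ∀ x, u x ∈ U1 𝔸) {V : Site d → Fin d → 𝔸ˣ} {lo hi : Site d} {a : ℝ}
    (h : B8Lemma1NonAbelian.PlaqSmall V lo hi a) : B8Lemma1NonAbelian.PlaqSmall (gaugeAct u V) lo hi a := by
  intro x κ μ hκμ hx hx'
  rw [norm_hol_gaugeAct_plaqWord hu]
  exact h x κ μ hκμ hx hx'

/-- **(1.130), FIRST MEMBER, RECORD TOWER, GLOBAL CARRIER, FOR EVERY ORBIT, FROM (1.128) DISPLAYED**: for `U₀` with values in `G ≤ U1 𝔸` whose record averages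
`avgIterZ L U₀ j`, `j ≤ k`, are `G`-valued and satisfy (1.128) on the tower (`|Ū₀^{k−n}(∂p) − 1| ≤ 2α₀L²·L^{−2n}` on `□̃^{(k−n)}` — gauge invariant, so it is the
same line for `U₀′`), `α₀L²` Prop.-1-small, the top cube `[lo, hi] ∋ y` with `|x − y|_∞ ≤ h`, `2h ≤ M + 4R₁M₁` and the printed smallness: the gauge-fixed
`U₀′ := U₀^{u}`, `u = towerGaugeZ L U₀ k y`, obeys `|Ū₀′^{k−n}(x, x + e_ν) − 1| ≤ 8d²L²(Σ_{m<n}L^{−2m})α₀ + (M + 4R₁M₁)dL²α₀` on every bond of `□̃^{(k−n)}` —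
`B8Ineq130Rec.ineq130_of128` with its gauge hypotheses supplied by `gaugeFix_global_of_mem`. [cite: Balaban1985RegularSpaces, (1.130) p.99, p.98, (1.15) p.78; Balaban1987RG1, (0.4) p.253] -/
theorem ineq130_global_fixed_of128 {L s : ℕ} (hL : L = 2 * s + 1) (hL2 : 2 ≤ L) (hd : 1 ≤ d) {G : Subgroup 𝔸ˣ} (hG1 : G ≤ U1 𝔸)
    (k : ℕ) (U : Site d → Fin d → 𝔸ˣ) (hU : ∀ x κ, U x κ ∈ G) (hmemG : ∀ j ≤ k, ∀ x μ, avgIterZ L U j x μ ∈ G)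
    {α₀ : ℝ} (hα : 0 < α₀) (hα3 : C0 d * (α₀ * (L : ℝ) ^ 2) ≤ 1 / 3) (lo hi : Site d)
    (h128 : ∀ n ≤ k, B8Lemma1NonAbelian.PlaqSmall (avgIterZ L U (k - n)) (tlo L lo n) (thi L hi n) (aLev α₀ L n))
    {y : Site d} {h : ℕ} (hy : lo ≤ y) (hy' : y ≤ hi) (hrad : ∀ κ, y κ - lo κ ≤ h ∧ hi κ - y κ ≤ h)
    {M R₁ M₁ : ℝ} (hside : 2 * (h : ℝ) ≤ M + 4 * R₁ * M₁)
    (hsmall : 11 * (d : ℝ) ^ 2 * (L : ℝ) ^ 2 * α₀ + (M + 4 * R₁ * M₁) * d * (L : ℝ) ^ 2 * α₀ ≤ 1 / 6)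
    (n : ℕ) (hn : n ≤ k) (x : Site d) (ν : Fin d) (hx : tlo L lo n ≤ x) (hxν : x + e ν ≤ thi L hi n) :
    ‖((avgIterZ L (gaugeAct (towerGaugeZ L U k y) U) (k - n) x ν : 𝔸ˣ) : 𝔸) - 1‖ ≤ bound130 d L α₀ M R₁ M₁ n := by
  obtain ⟨huG, -, -, hcov, h15, hgax⟩ := gaugeFix_global_of_mem hL hG1 k U hU hmemG y
  have huU : ∀ j x, uLev L (towerGaugeZ L U k y) j x ∈ U1 𝔸 := fun j x => hG1 (huG _)
  have hmem' : ∀ j ≤ k, ∀ x μ, avgIterZ L (gaugeAct (towerGaugeZ L U k y) U) j x μ ∈ U1 𝔸 := fun j hj x μ => by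
    rw [hcov j]
    exact gaugeAct_mem (fun x μ => hG1 (hmemG j hj x μ)) (huU j) x μ
  have h128' : ∀ m ≤ k, B8Lemma1NonAbelian.PlaqSmall (avgIterZ L (gaugeAct (towerGaugeZ L U k y) U) (k - m)) (tlo L lo m) (thi L hi m)
      (aLev α₀ L m) := fun m hm => by
    rw [hcov (k - m)]
    exact plaqSmall_gaugeAct (huU _) (h128 m hm)
  exact ineq130_of128 hL hL2 hd k _ hα hα3 lo hi hmem' h128' (fun n hn z _ _ r => h15 n hn z r) hy hy' hrad
    (fun z _ _ => hgax z) hside hsmall n hn x ν hx hxν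

end Analytic

end Literature.MathematicalPhysics.QuantumFieldTheory.Balaban1983to89.B8Eq115GaugeFixingRec

/-! ## Axiom audit (gate whitelist: `propext`, `Classical.choice`, `Quot.sound`) -/
#print axioms Literature.MathematicalPhysics.QuantumFieldTheory.Balaban1983to89.B8Eq115GaugeFixingRec.gaugeFix_global_of_mem
#print axioms Literature.MathematicalPhysics.QuantumFieldTheory.Balaban1983to89.B8Eq115GaugeFixingRec.gaugeFix_unique_normalised
#print axioms Literature.MathematicalPhysics.QuantumFieldTheory.Balaban1983to89.B8Eq115GaugeFixingRec.ineq130_global_fixed_of128
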